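/-
COR-CM (cell pub-hodgecm2, stage 2 of the Hodge ladder) — Δ2 BRIDGE, the μ ↦ μᶜ ADAPTER at the literal pin, SUB-LEMMA (A3):
the [Prop 4.13] ∕ [Def 4.11] ∕ [Lem D.1 (3)] ∕ [Lem D.1 (1)] LEGS OF THE ASSEMBLY `AdapterMuConj.thm418C_liuDictionaryPin_of_muConj`
(✔ p373344) — its binders `h413C ∕ h411C ∕ hsepC ∕ hnvDC` at the relabelled family `muConj U` — DERIVED from the same legs at the
un-relabelled family `U` (the END's displayed `h413 ∕ h411 ∕ hμsep ∕ hD1′`), by the re-indexing `(ν, ε, χ) ↦ (νᶜ, ε, χ)` of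
[Liu2021, Prop. 4.13]'s direct sum, under which the summands coincide ON THE NOSE (`muConj_omega`, `rfl`).
Seat prover-pub-hodgecm2-d2bridge-prove-7-g1-0 (d2bridge-prove-7, Ω-pin lineage).  THEOREMS ONLY (kernel lane): no definition, no
instance, no named fact, no `sorry`; nothing landed is edited or restated.  HC_CM is NOT proved; «Δ2 BRIDGE CLOSED» is NOT claimed.
-/
import Summits.HodgeConjecture.CorCM.D2Bridge.AdapterMuConj
import Summits.HodgeConjecture.CorCM.D2Bridge.AdapterMuConjIndex
import HarnessLib

set_option autoImplicit false

/-!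
# The μ ↦ μᶜ adapter: the Prop 4.13 ∕ Def 4.11 ∕ Lem D.1 legs at `muConj U` from those at `U`

[Liu2021] Y. Liu, *Fourier–Jacobi cycles and arithmetic relative trace formula*, Camb. J. Math. **9** (2021) = arXiv:2102.11518.

`muConj U` (✔ `AdapterMuConj.lean`) re-labels the μ-uniform oscillator carriers `U : UniformOmega C` by `ν ↦ νᶜ := ν ∘ c`
([Liu2021] Rem. 4.4) and reads Def. 4.12's collection map at `−e`.  On [Prop. 4.13]'s index set of «all adèlic oscillator triples
in which `μ` is of weight one and `ε` is `μ`-admissible» the map `(ν, ε, χ) ↦ (νᶜ, ε, χ)` is a BIJECTION from the triples of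
`(muConj U).prop413Data H` onto those of `U.prop413Data H` (weight one: Rem. 4.4; admissibility: Def. 4.12, last sentence, with the
witness `e ↦ −e`), and the summand `ω` and its `𝔾(𝔸_F^∞)`-action at a triple and at its image are the SAME carrier (`rfl`).  Hence:

* `prop413AsPrinted_muConj` — [Prop. 4.13] AS PRINTED for `U.prop413Data H` ⟹ for `(muConj U).prop413Data H` (compose the printed
  isomorphism with the re-indexing of the direct sum, `DirectSum.lequivCongrLeft`);
* `def411_muConj` — the [Def. 4.11] leg (irreducible ∕ smooth ∕ admissible summands) transfers triple by triple;
* `sep_muConj` — the [Lem. D.1 (3)] separation leg transfers (the re-indexing is injective);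
* `nontrivial_omegaAt_muConj_rest` — the [Lem. D.1 (1)] non-vanishing leg at the `ν`-rest of `muConj U` from the one at the `μ`-rest of
  `U` (`μ = νᶜ`), for EVERY admissible index (✔ `nontrivial_omegaAt_muConj` along the surjective ✔ `admIndexMuConjEquiv`).

These are exactly the binders `h413C ∕ h411C ∕ hsepC ∕ hnvDC` of ✔ `thm418C_liuDictionaryPin_of_muConj`, so that the by-value END over the
adapter displays the UN-relabelled citations `h413 ∕ h411 ∕ hμsep ∕ hD1′` only.  Nothing about Liu's objects is asserted.

## References
* [Liu2021] Prop. 4.13 (FJcycle.tex ll. 2113–2119), Def. 4.11–4.12 (ll. 2083–2111), Rem. 4.4 (ll. 1912–1933), App. D Lem. D.1 (1)–(3)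
  (ll. 5226–5233), Thm. 4.18 (ll. 2232–2245).
* Tree: `CorCM/D2Bridge/AdapterMuConj.lean` (`muConj`, `admIndexMuConjEquiv`, `nontrivial_omegaAt_muConj`),
  `Literature/NumberTheory/Automorphic/IdeleClassCharacterConjugate.lean` (`galConj`, Rem. 4.4 lemmas),
  `CorCM/D2Bridge/AdapterMuConjIndex.lean` (Def. 4.12 on index sets), `Liu2021/AppendixC/Prop413DataOfTower.lean` (`UniformOmega.prop413Data`),
  `Liu2021/Prop413AsPrinted.lean`.
-/

noncomputable section

open scoped DirectSum

namespace Summit.HodgeConjecture.CorCM.D2Bridge.AdapterMuConj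

open NumberField
open Literature.NumberTheory.Automorphic Literature.NumberTheory.Automorphic.IdeleClassGroup
open Literature.NumberTheory.Automorphic.Liu2021 Literature.NumberTheory.Automorphic.Liu2021.AppendixC
open Literature.NumberTheory.ComplexMultiplication.CMTypeOps (bar bar_bar coe_bar_eq_setOf_conjugate_mem)
open Literature.AlgebraicGeometry.Liu2021 (IsAdmissibleElement isAdmissibleElement_conj_neg_iff)
open Literature.RepresentationTheory

section Legs

/- As in `AdapterMuConj.lean` §1: every structure ∕ class parameter of the App-C context is IMPLICIT, the CM-field instance on `E` is
AppendixC's `isCMField F E` (`letI`). -/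
variable {F E : Type} {iF₁ : Field F} {iF₂ : NumberField F} {iF₃ : IsTotallyReal F} {iE₁ : Field E} {iE₂ : NumberField E}
  {iA : Algebra F E} {iE₃ : IsTotallyComplex E} {iQ : Algebra.IsQuadraticExtension F E}
variable {P5 : PropC5Data F E} {isotropicAt : ℕ → Prop} {C : Sec42Data P5 isotropicAt}
variable (U : UniformOmega C) (H : Type) [AddCommGroup H] [Module ℂ H] [Module (MonoidAlgebra ℂ C.G) H]
  [IsScalarTower ℂ (MonoidAlgebra ℂ C.G) H]

/-- Two adèlic oscillator triples with the same character, collection and `χ` are equal (the conjugate-symplectic field is a proof).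
[cite: Liu2021, Def. 4.11 (FJcycle.tex ll. 2084–2090)] -/
theorem triple_eq_of_eq {P : Prop413Data F E} {t t' : P.Triple} (hμ : t.μ = t'.μ) (hε : t.ε = t'.ε) (hχ : t.χ = t'.χ) : t = t' := by
  cases t; cases t'
  cases hμ; cases hε; cases hχ
  rfl

/-- **The conjugate triple is again an index of [Prop. 4.13]'s sum**: if `(ν, ε, χ)` is a weight-one, admissible triple of
`(muConj U).prop413Data H` (admissibility through `e ↦ U.epsOf (−e)` at `Φ_ν`), then `(νᶜ, ε, χ)` is one of `U.prop413Data H`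
(Rem. 4.4: `νᶜ` conjugate symplectic of weight one; Def. 4.12, last sentence: witness `−e`). [cite: Liu2021, Rem. 4.4 (ll. 1912–1933); Def. 4.12 (ll. 2102–2111)] -/
theorem conjTriple_mem (t : ((muConj U).prop413Data H).AdmTriple) :
    letI : IsCMField E := isCMField F E
    Prop413Data.Triple.HasWeightOne (P := U.prop413Data H)
        ⟨galConj (IsCMField.complexConj E) t.1.μ, t.1.isConjugateSymplectic.galConj, t.1.ε, t.1.χ⟩ ∧
      Prop413Data.Triple.IsAdmissible (P := U.prop413Data H)
        ⟨galConj (IsCMField.complexConj E) t.1.μ, t.1.isConjugateSymplectic.galConj, t.1.ε, t.1.χ⟩ := by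
  letI : IsCMField E := isCMField F E
  refine ⟨HasWeight.galConj_complexConj t.2.1, ?_⟩
  exact (Summit.HodgeConjecture.CorCM.D2Bridge.AdapterRelabel.exists_isAdmissibleElement_cmType_neg_iff_galConj
    t.1.isConjugateSymplectic U.epsOf t.1.ε).1 t.2.2

/-- … and conversely: if `(μ, ε, χ)` is a weight-one admissible triple of `U.prop413Data H`, then `(μᶜ, ε, χ)` is one of
`(muConj U).prop413Data H`. [cite: Liu2021, Rem. 4.4 (ll. 1912–1933); Def. 4.12 (ll. 2102–2111)] -/
theorem conjTriple_mem' (s : (U.prop413Data H).AdmTriple) :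
    letI : IsCMField E := isCMField F E
    Prop413Data.Triple.HasWeightOne (P := (muConj U).prop413Data H)
        ⟨galConj (IsCMField.complexConj E) s.1.μ, s.1.isConjugateSymplectic.galConj, s.1.ε, s.1.χ⟩ ∧
      Prop413Data.Triple.IsAdmissible (P := (muConj U).prop413Data H)
        ⟨galConj (IsCMField.complexConj E) s.1.μ, s.1.isConjugateSymplectic.galConj, s.1.ε, s.1.χ⟩ := by
  letI : IsCMField E := isCMField F E
  refine ⟨HasWeight.galConj_complexConj s.2.1, ?_⟩
  exact (Summit.HodgeConjecture.CorCM.D2Bridge.AdapterRelabel.exists_isAdmissibleElement_cmType_galConj_neg_iff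
    s.1.isConjugateSymplectic U.epsOf s.1.ε).2 s.2.2

/-- **[Liu2021, Prop. 4.13] AS PRINTED transfers to the relabelled family**: an equivariant isomorphism
`H ≃ ⊕_{(μ,ε,χ)} ω(μ, ε, χ)` over the weight-one admissible triples of `U` IS one over those of `muConj U` after re-indexing the sum by
`(ν, ε, χ) ↦ (νᶜ, ε, χ)` (a bijection, inverse `(μ, ε, χ) ↦ (μᶜ, ε, χ)` as `(νᶜ)ᶜ = ν`) — the summands agree on the nose.
(= binder `h413C` of ✔ `thm418C_liuDictionaryPin_of_muConj`, from the END's `h413`.)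
[cite: Liu2021, Prop. 4.13 (FJcycle.tex ll. 2113–2119); Rem. 4.4 (ll. 1912–1933); Def. 4.12 (ll. 2102–2111)] -/
theorem prop413AsPrinted_muConj (h413 : Prop413AsPrinted (U.prop413Data H)) :
    Prop413AsPrinted ((muConj U).prop413Data H) := by
  letI : IsCMField E := isCMField F E
  intro hn τ'
  obtain ⟨Φ, hΦ⟩ := h413 hn τ'
  -- the re-indexing `(μ, ε, χ) ↦ (μᶜ, ε, χ)`, inverse `(ν, ε, χ) ↦ (νᶜ, ε, χ)`
  let eT : (U.prop413Data H).AdmTriple ≃ ((muConj U).prop413Data H).AdmTriple :=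
    { toFun := fun s => ⟨⟨galConj (IsCMField.complexConj E) s.1.μ, s.1.isConjugateSymplectic.galConj, s.1.ε, s.1.χ⟩,
        conjTriple_mem' U H s⟩
      invFun := fun t => ⟨⟨galConj (IsCMField.complexConj E) t.1.μ, t.1.isConjugateSymplectic.galConj, t.1.ε, t.1.χ⟩,
        conjTriple_mem U H t⟩
      left_inv := fun s => Subtype.ext (triple_eq_of_eq (galConj_complexConj_galConj_complexConj s.1.μ) rfl rfl)
      right_inv := fun t => Subtype.ext (triple_eq_of_eq (galConj_complexConj_galConj_complexConj t.1.μ) rfl rfl) }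
  refine ⟨Φ ≪≫ₗ DirectSum.lequivCongrLeft ℂ eT, fun g x t => ?_⟩
  -- the re-indexed sum, componentwise: `(L y) t = y (eT⁻¹ t)`
  have key : ∀ (y : ⨁ s : (U.prop413Data H).AdmTriple, (U.prop413Data H).omegaAt s) (t : ((muConj U).prop413Data H).AdmTriple),
      (DirectSum.lequivCongrLeft ℂ eT y) t = y (eT.symm t) := fun y t => DirectSum.lequivCongrLeft_apply _ _ _ _
  have h1 : (DirectSum.lequivCongrLeft ℂ eT (Φ (((U.prop413Data H).rhoB τ') g x))) t =
      Φ (((U.prop413Data H).rhoB τ') g x) (eT.symm t) := key _ _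
  have h2 : (DirectSum.lequivCongrLeft ℂ eT (Φ x)) t = Φ x (eT.symm t) := key _ _
  exact h1.trans ((hΦ g x (eT.symm t)).trans (congrArg ((((muConj U).prop413Data H).rhoAt t) g) h2).symm)

/-- **The [Def. 4.11] leg transfers**: irreducibility-or-zero, smoothness and admissibility of the summands `ω(ν, ε, χ)` of the
relabelled family are those of the summands `ω(νᶜ, ε, χ)` of `U` — the same representation.  (= binder `h411C`, from the END's `h411`.)
[cite: Liu2021, Def. 4.11 (FJcycle.tex ll. 2092–2096); Rem. 4.4] -/
theorem def411_muConj
    (h411 : ∀ t : (U.prop413Data H).AdmTriple, IsIrreducibleOrZero ((U.prop413Data H).rhoAt t) ∧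
      IsSmoothRep ((U.prop413Data H).rhoAt t) ∧ IsAdmissibleRep ((U.prop413Data H).rhoAt t))
    (t : ((muConj U).prop413Data H).AdmTriple) :
    IsIrreducibleOrZero (((muConj U).prop413Data H).rhoAt t) ∧ IsSmoothRep (((muConj U).prop413Data H).rhoAt t) ∧
      IsAdmissibleRep (((muConj U).prop413Data H).rhoAt t) := by
  letI : IsCMField E := isCMField F E
  exact h411 ⟨⟨galConj (IsCMField.complexConj E) t.1.μ, t.1.isConjugateSymplectic.galConj, t.1.ε, t.1.χ⟩, conjTriple_mem U H t⟩

/-- **The [Lem. D.1 (3)] separation leg transfers**: if equivariantly isomorphic non-zero summands of `U` have equal triples, so do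
those of `muConj U` (the re-indexing `(ν, ε, χ) ↦ (νᶜ, ε, χ)` is injective, `(νᶜ)ᶜ = ν`).  (= binder `hsepC`, from the END's `hμsep`.)
[cite: Liu2021, App. D Lem. D.1 (3) (FJcycle.tex l. 5233); Rem. 4.4] -/
theorem sep_muConj
    (hsep : ∀ s t : (U.prop413Data H).AdmTriple, Nontrivial ((U.prop413Data H).omegaAt s) →
      (∃ f : (U.prop413Data H).omegaAt s ≃ₗ[ℂ] (U.prop413Data H).omegaAt t,
        ∀ (g : C.G) (v : (U.prop413Data H).omegaAt s), f ((U.prop413Data H).rhoAt s g v) = (U.prop413Data H).rhoAt t g (f v)) → s = t)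
    (s t : ((muConj U).prop413Data H).AdmTriple) (hs : Nontrivial (((muConj U).prop413Data H).omegaAt s))
    (hf : ∃ f : ((muConj U).prop413Data H).omegaAt s ≃ₗ[ℂ] ((muConj U).prop413Data H).omegaAt t,
      ∀ (g : C.G) (v : ((muConj U).prop413Data H).omegaAt s),
        f (((muConj U).prop413Data H).rhoAt s g v) = ((muConj U).prop413Data H).rhoAt t g (f v)) :
    s = t := by
  letI : IsCMField E := isCMField F E
  have h := hsep ⟨⟨galConj (IsCMField.complexConj E) s.1.μ, s.1.isConjugateSymplectic.galConj, s.1.ε, s.1.χ⟩, conjTriple_mem U H s⟩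
    ⟨⟨galConj (IsCMField.complexConj E) t.1.μ, t.1.isConjugateSymplectic.galConj, t.1.ε, t.1.χ⟩, conjTriple_mem U H t⟩ hs hf
  have hμ : s.1.μ = t.1.μ := by
    have h1 := congrArg (fun r : (U.prop413Data H).AdmTriple => galConj (IsCMField.complexConj E) r.1.μ) h
    simpa only [galConj_complexConj_galConj_complexConj] using h1
  exact Subtype.ext (triple_eq_of_eq hμ (congrArg (fun r : (U.prop413Data H).AdmTriple => r.1.ε) h)
    (congrArg (fun r : (U.prop413Data H).AdmTriple => r.1.χ) h))

/-- **The [Lem. D.1 (1)] non-vanishing leg transfers** (`μ = νᶜ`): if every summand `ω_i` of [Thm. 4.18] at the `μ`-rest of `U` is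
non-zero, so is every summand at the `ν`-rest of `muConj U` (every admissible index there is the image of one at the `μ`-rest under
✔ `admIndexMuConjEquiv`, along which ✔ `nontrivial_omegaAt_muConj`).  (= binder `hnvDC`, from the END's `hD1′`-leg `hnvD`.)
[cite: Liu2021, App. D Lem. D.1 (1) (FJcycle.tex l. 5226); Thm. 4.18 (ll. 2232–2237)] -/
theorem nontrivial_omegaAt_muConj_rest {μ ν : Literature.NumberTheory.Automorphic.IdeleClassGroup E →ₜ* Circle}
    {hμ : letI : IsCMField E := isCMField F E; IdeleClassGroup.IsConjugateSymplectic E μ}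
    {hν : letI : IsCMField E := isCMField F E; IdeleClassGroup.IsConjugateSymplectic E ν}
    (t : RestTail C μ hμ) (tc : RestTail C ν hν)
    (h : letI : IsCMField E := isCMField F E; μ = galConj (IsCMField.complexConj E) ν)
    (hnvD : ∀ i : (toThm418Data C (U.rest t)).AdmIndex, Nontrivial ((toThm418Data C (U.rest t)).omegaAt i))
    (j : (toThm418Data C ((muConj U).rest tc)).AdmIndex) :
    Nontrivial ((toThm418Data C ((muConj U).rest tc)).omegaAt j) := by
  have hj := nontrivial_omegaAt_muConj U t tc h ((admIndexMuConjEquiv U t tc h).symm j)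
    (hnvD ((admIndexMuConjEquiv U t tc h).symm j))
  rwa [Equiv.apply_symm_apply] at hj

end Legs

end Summit.HodgeConjecture.CorCM.D2Bridge.AdapterMuConj

end
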